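import Summits.QuantumFields.YangMills.Theorems.LuscherReductionTwistedTraceScalingWindowCopies
import Summits.QuantumFields.YangMills.Theorems.LuscherReductionTwistedTraceScalingOnionRefinedScales
import Summits.QuantumFields.YangMills.Theorems.LuscherReductionRunningReductionOneSiteTailClosed
import HarnessLib

/-!
# ★★★ THE BORN–OPPENHEIMER WINDOW BO-WINDOW(L): the refined onion run ONCE FOR ALL LEVELS with the `k`-uniform inner window and the LOG-RATE valley gain
# (brick W6 of the lattice window floor W(L); lane A of S-BASE, crux `TwistedTraceScaling` stmt-QuantumFields-20203, line «twolattice», stub `stub_fixedLatticeTraceLaw`;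
# card `pub/ym-fleet/ym-luscher-20007-p1/Lines-window-floor.md`; lead g24)

The `k`-uniform twin of ✓`boUpper_of_valley_inner₂` (`…OnionRefinedGlue`).  Inputs: refined-admissible scales (✓`ScalesAdmissible₂`), the valley gain WITH LOG RATE `ValleyGainLogAt L δ η`
and the `k`-uniform inner window `InnerWindowAt L δ` (✓`…WindowDefs`).  Output — BO-WINDOW(L):
  `∀ c, ∀ ε > 0, ∃ β₀, ∀ β ≥ β₀, ∀ k, λ_k(β,L)·μ₀ ≤ (max μ_k (e^{−(c·log β)·λ_b}·μ₀) + ε·λ_b·μ₀)·λ₀(β,L)`  (`μ_j = levelValue su2Rep 1 (L³β) j`, `λ_b = bareLambda(L³β)`),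
i.e. `λ_k/λ₀ ≤ max(μ_k/μ₀, β^{−cλ_b}) + ελ_b` at ONE threshold for ALL levels.  Proof: for each `k` at a fixed large `β`, the exact eigenfamily `e₀…e_k` (✓`exists_isPhys_eigenfamily_of_pos`) is
cut by the refined onion ✓`qform_le_three_regions_lat₂`; the valley piece is `≤ e^{−(c log β)λ_b}λ₀‖·‖²`, the cut costs `(ε/8)λ_bλ₀` through ✓`levelValue_zero_ge_uniform`, and the inner family
gets the window from `InnerWindowAt` (or is Gram-degenerate); the stiff cap `θμ₀` sits below `e^{−(c log β)λ_b}μ₀` eventually (`log_rate_eventually_small`, ✓`OST.log_mul_bareLambda_le`).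
* `log_rate_eventually_small`, `window_onion_endgame`;
* ★★★ `boWindow_of_valleyLog_innerWindow₂`; ★★★ `boWindow_pow` — at `(δ, η) = (β^{−p}, β^{−q})`, `0 < p < 1/3`, `q < 8/9`, from `ValleyGainLogAt` and the ONE-ORBIT window `InnerWindowOneOrbitAt`.
HONEST FRAMING: a reduction at fixed lattice size, eventually in `β`; the log-rate valley gain is OPEN here (bricks R1–R5 of the card); W(L), S-BASE, the crux stay OPEN; CONDITIONAL route R2b1;
not infinite volume, not a mass gap, not Clay.  No definitions, no `sorry`.
-/

set_option autoImplicit false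

noncomputable section

open MeasureTheory Filter Topology Real
open scoped BigOperators
open Literature.MathematicalPhysics.QuantumFieldTheory
open Literature.MathematicalPhysics.QuantumLattice

namespace Summit.QuantumFields.YangMills.Theorems.FemtoTransferGap

variable {L : ℕ} [NeZero L]

/-! ## §1 Arithmetic -/

/-- A log rate is `o(1)` in femto units: for every `c` and `t > 0`, eventually `(c·log β)·λ_b(L³β) ≤ t` (`log B·λ_b(B) → 0`, ✓`OST.log_mul_bareLambda_le`). [folklore] -/
theorem log_rate_eventually_small (c : ℝ) {t : ℝ} (ht : 0 < t) :
    ∃ β0 : ℝ, ∀ β : ℝ, β0 ≤ β → c * Real.log β * bareLambda ((L : ℝ) ^ 3 * β) ≤ t := by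
  have hL1 : (1 : ℝ) ≤ (L : ℝ) ^ 3 := one_le_pow₀ (by exact_mod_cast NeZero.one_le)
  obtain ⟨T, hT1, hT⟩ := OST.log_mul_bareLambda_le (c := t / (|c| + 1)) (by positivity)
  refine ⟨max T 1, fun β hβ => ?_⟩
  have hβ1 : 1 ≤ β := (le_max_right _ _).trans hβ
  have hβT : T ≤ β := (le_max_left _ _).trans hβ
  have hβ0 : 0 < β := by linarith
  set B : ℝ := (L : ℝ) ^ 3 * β with hB
  have hBβ : β ≤ B := by rw [hB]; nlinarith
  have hB1 : 1 ≤ B := hβ1.trans hBβ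
  have hBT : T ≤ B := hβT.trans hBβ
  have hlam0 : 0 ≤ bareLambda B := (bareLambda_pos' (by linarith)).le
  have hlogβ : 0 ≤ Real.log β := Real.log_nonneg hβ1
  have hlogB : Real.log β ≤ Real.log B := Real.log_le_log hβ0 hBβ
  have h1 : Real.log B * bareLambda B ≤ t / (|c| + 1) := by
    refine (hT B hBT).trans ?_
    have : B ^ (-(1 / 4 : ℝ)) ≤ 1 := Real.rpow_le_one_of_one_le_of_nonpos hB1 (by norm_num)
    have ht' : 0 ≤ t / (|c| + 1) := by positivity
    nlinarith
  calc c * Real.log β * bareLambda B ≤ |c| * (Real.log β * bareLambda B) := by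
        rw [mul_assoc]; exact mul_le_mul_of_nonneg_right (le_abs_self c) (mul_nonneg hlogβ hlam0)
    _ ≤ |c| * (Real.log B * bareLambda B) := mul_le_mul_of_nonneg_left (mul_le_mul_of_nonneg_right hlogB hlam0) (abs_nonneg c)
    _ ≤ |c| * (t / (|c| + 1)) := mul_le_mul_of_nonneg_left h1 (abs_nonneg c)
    _ ≤ t := by
        rw [mul_div_assoc']
        rw [div_le_iff₀ (by positivity)]
        nlinarith [abs_nonneg c]

/-- ★ **The endgame of the window onion** (all quantities abstract): the key estimate for the chosen combination, the INNER window and `θμ₀ ≤ Eμ₀` give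
`λ_k μ₀ ≤ (max μ_k (Eμ₀) + ελμ₀)·λ₀`. [folklore] -/
theorem window_onion_endgame {lk μ0 μk Λ0 lam ε E θ n nin q : ℝ} (hn : 0 < n) (hnin0 : 0 ≤ nin) (hnin1 : nin ≤ n) (hΛ0 : 0 ≤ Λ0)
    (hμ0 : 0 ≤ μ0) (hlam : 0 ≤ lam) (hε : 0 ≤ ε) (hE0 : 0 ≤ E) (hθE : θ * μ0 ≤ E * μ0)
    (hkey : lk * μ0 * n ≤ q * μ0 + E * Λ0 * μ0 * (n - nin) + ε / 8 * lam * Λ0 * μ0 * n)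
    (hI : q * μ0 ≤ (max μk (θ * μ0) + ε / 2 * lam * μ0) * Λ0 * nin) :
    lk * μ0 ≤ (max μk (E * μ0) + ε * lam * μ0) * Λ0 := by
  set W : ℝ := max μk (E * μ0) with hW
  have hW1 : max μk (θ * μ0) ≤ W := max_le_max le_rfl hθE
  have hEW : E * μ0 ≤ W := le_max_right _ _
  have hW0 : 0 ≤ W := le_trans (mul_nonneg hE0 hμ0) hEW
  have h1 : q * μ0 ≤ (W + ε / 2 * lam * μ0) * Λ0 * nin := by
    refine hI.trans (mul_le_mul_of_nonneg_right (mul_le_mul_of_nonneg_right (by linarith) hΛ0) hnin0)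
  have h2 : E * Λ0 * μ0 * (n - nin) ≤ W * Λ0 * (n - nin) := by
    have := mul_le_mul_of_nonneg_right hEW (mul_nonneg hΛ0 (sub_nonneg.mpr hnin1))
    nlinarith
  have h3 : lk * μ0 * n ≤ (W + ε * lam * μ0) * Λ0 * n := by
    have h4 : (W + ε / 2 * lam * μ0) * Λ0 * nin + W * Λ0 * (n - nin) + ε / 8 * lam * Λ0 * μ0 * n ≤ (W + ε * lam * μ0) * Λ0 * n := by
      have h5 : ε / 2 * lam * μ0 * Λ0 * nin ≤ ε / 2 * lam * μ0 * Λ0 * n := mul_le_mul_of_nonneg_left hnin1 (by positivity)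
      nlinarith [h5, mul_nonneg (mul_nonneg (mul_nonneg hε hlam) hμ0) (mul_nonneg hΛ0 hn.le)]
    linarith [hkey, h1, h2, h4]
  exact le_of_mul_le_mul_right h3 hn

/-! ## §2 ★★★ BO-WINDOW(L) from the log-rate valley gain and the `k`-uniform inner window -/

set_option maxHeartbeats 800000 in
/-- ★★★ **BO-WINDOW(L)**: at refined-admissible scales, `ValleyGainLogAt L δ η` and `InnerWindowAt L δ` give, for every `c` and `ε > 0`, ONE threshold `β₀` such that for all `β ≥ β₀` and ALL `k`:
`λ_k(β,L)·μ₀ ≤ (max μ_k (e^{−(c·log β)λ_b}μ₀) + ελ_bμ₀)·λ₀(β,L)`.  Proof = ✓`boUpper_of_valley_inner₂` run once for all levels (no crux ONE). [cite: Luscher1983, §3] [cite: SimonB1983DiscreteSpectrum, §3] -/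
theorem boWindow_of_valleyLog_innerWindow₂ {δ η : ℝ → ℝ} (hS : ScalesAdmissible₂ L δ η) (hV : ValleyGainLogAt L δ η) (hI : InnerWindowAt L δ) :
    ∀ c : ℝ, ∀ ε : ℝ, 0 < ε → ∃ β0 : ℝ, ∀ β : ℝ, β0 ≤ β → ∀ k : ℕ,
      levelValue su2Rep L β k * levelValue su2Rep 1 ((L : ℝ) ^ 3 * β) 0 ≤
        (max (levelValue su2Rep 1 ((L : ℝ) ^ 3 * β) k) (Real.exp (-(c * Real.log β * bareLambda ((L : ℝ) ^ 3 * β))) * levelValue su2Rep 1 ((L : ℝ) ^ 3 * β) 0) +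
            ε * bareLambda ((L : ℝ) ^ 3 * β) * levelValue su2Rep 1 ((L : ℝ) ^ 3 * β) 0) * levelValue su2Rep L β 0 := by
  intro c ε hε
  obtain ⟨hδ, hη, hErr⟩ := hS
  obtain ⟨θ, hθ, hIε⟩ := hI
  obtain ⟨βV, hV'⟩ := hV c
  obtain ⟨βI, hI'⟩ := hIε (ε / 2) (half_pos hε)
  obtain ⟨βE, hE⟩ := hErr (ε / 8) (by positivity)
  -- the stiff cap sits below the valley factor eventually: `θ ≤ e^{−(c log β)λ_b}`
  have hθpos_or := le_or_gt θ 0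
  obtain ⟨βθ, hβθ⟩ : ∃ βθ : ℝ, ∀ β : ℝ, βθ ≤ β → θ ≤ Real.exp (-(c * Real.log β * bareLambda ((L : ℝ) ^ 3 * β))) := by
    rcases hθpos_or with hθ0 | hθ0
    · exact ⟨0, fun β _ => hθ0.trans (Real.exp_pos _).le⟩
    · obtain ⟨β0, hβ0⟩ := log_rate_eventually_small (L := L) c (t := -Real.log θ) (by have := Real.log_neg hθ0 hθ; linarith)
      refine ⟨β0, fun β hβ => ?_⟩
      have h := hβ0 β hβ
      calc θ = Real.exp (Real.log θ) := (Real.exp_log hθ0).symm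
        _ ≤ Real.exp (-(c * Real.log β * bareLambda ((L : ℝ) ^ 3 * β))) := Real.exp_le_exp.mpr (by linarith)
  refine ⟨max (max 1 βθ) (max (max βV βI) βE), fun β hβ k => ?_⟩
  have hβ1 : 1 ≤ β := ((le_max_left _ _).trans (le_max_left _ _)).trans hβ
  have hβ0 : 0 < β := by linarith
  have hβθ' : βθ ≤ β := ((le_max_right _ _).trans (le_max_left _ _)).trans hβ
  have hβV : βV ≤ β := (((le_max_left _ _).trans (le_max_left _ _)).trans (le_max_right _ _)).trans hβ
  have hβI : βI ≤ β := (((le_max_right _ _).trans (le_max_left _ _)).trans (le_max_right _ _)).trans hβ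
  have hβE : βE ≤ β := ((le_max_right _ _).trans (le_max_right _ _)).trans hβ
  -- the natural coupling and the one-site data
  have hL1 : (1 : ℝ) ≤ (L : ℝ) ^ 3 := one_le_pow₀ (by exact_mod_cast NeZero.one_le)
  have hB'β : β ≤ (L : ℝ) ^ 3 * β := by nlinarith
  have hB'0 : 0 < (L : ℝ) ^ 3 * β := lt_of_lt_of_le hβ0 hB'β
  have hμ0 : 0 < levelValue su2Rep 1 ((L : ℝ) ^ 3 * β) 0 := levelValue_su2Rep_pos (L := 1) hB'0 0
  have hlam0 : 0 < bareLambda ((L : ℝ) ^ 3 * β) := bareLambda_pos' hB'0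
  have hΛ0 : 0 < levelValue su2Rep L β 0 := levelValue_su2Rep_pos hβ0 0
  set E : ℝ := Real.exp (-(c * Real.log β * bareLambda ((L : ℝ) ^ 3 * β))) with hEdef
  have hE0 : 0 ≤ E := (Real.exp_pos _).le
  have hθE : θ * levelValue su2Rep 1 ((L : ℝ) ^ 3 * β) 0 ≤ E * levelValue su2Rep 1 ((L : ℝ) ^ 3 * β) 0 :=
    mul_le_mul_of_nonneg_right (hβθ β hβθ') hμ0.le
  -- the error budget through the floor
  have herr : onionErr₂ L β (δ β) (η β) * latCE L β ≤ ε / 8 * bareLambda ((L : ℝ) ^ 3 * β) * levelValue su2Rep L β 0 := by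
    have h := mul_le_mul_of_nonneg_right (hE β hβE) (latCE_pos (L := L) hβ0.le).le
    refine h.trans ?_
    rw [mul_assoc (ε / 8 * bareLambda ((L : ℝ) ^ 3 * β))]
    exact mul_le_mul_of_nonneg_left (levelValue_zero_ge_uniform hβ1) (by positivity)
  -- the exact eigenfamily and its inner pieces
  obtain ⟨e, he, hon, heig⟩ := exists_isPhys_eigenfamily_of_pos (L := L) hβ0 k
  obtain ⟨F, hFdef⟩ : ∃ F : Fin (k + 1) → GaugeConfig 3 L SU2 → ℝ, F = fun i U => Real.cos (innerPhase (δ β) U) * e i U := ⟨_, rfl⟩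
  have hFphys : ∀ i, IsPhys (F i) := fun i => by rw [hFdef]; exact isPhys_inner (δ β) (he i)
  have hFsupp : ∀ i U, F i U ≠ 0 → ∃ z : Fin 3 → Bool, orbitDist (TT.twist3 z U) < δ β := fun i U h => by
    rw [hFdef] at h
    exact exists_orbitDist_lt_of_cos_ne_zero (hδ β) (left_ne_zero_of_mul h)
  -- KEY ESTIMATE for every coefficient vector
  have key : ∀ a : Fin (k + 1) → ℝ,
      0 ≤ l2 (fun U => ∑ i, a i * F i U) (fun U => ∑ i, a i * F i U) ∧
      l2 (fun U => ∑ i, a i * F i U) (fun U => ∑ i, a i * F i U) ≤ ∑ i, a i ^ 2 ∧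
      levelValue su2Rep L β k * levelValue su2Rep 1 ((L : ℝ) ^ 3 * β) 0 * ∑ i, a i ^ 2 ≤
        qform su2Rep β (fun U => ∑ i, a i * F i U) (fun U => ∑ i, a i * F i U) * levelValue su2Rep 1 ((L : ℝ) ^ 3 * β) 0
          + E * levelValue su2Rep L β 0 * levelValue su2Rep 1 ((L : ℝ) ^ 3 * β) 0 *
              (∑ i, a i ^ 2 - l2 (fun U => ∑ i, a i * F i U) (fun U => ∑ i, a i * F i U))
          + ε / 8 * bareLambda ((L : ℝ) ^ 3 * β) * levelValue su2Rep L β 0 * levelValue su2Rep 1 ((L : ℝ) ^ 3 * β) 0 * ∑ i, a i ^ 2 := by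
    intro a
    have hψ : IsPhys (fun U => ∑ i, a i * e i U) := isPhys_sum_mul_lat Finset.univ e he a
    obtain ⟨hn, hq⟩ := forms_of_eigenfamily_lat he hon heig a
    have hin : (fun U => Real.cos (innerPhase (δ β) U) * ∑ i, a i * e i U) = fun U => ∑ i, a i * F i U := by
      rw [hFdef]; exact cut_sum_mul _ a e
    -- onion
    have honion := qform_le_three_regions_lat₂ hβ0 (hδ β) (hη β) hψ
    rw [hin, hn] at honion
    -- valley (log rate)
    have hψoutP : IsPhys (fun U => Real.sin (innerPhase (δ β) U) * ∑ i, a i * e i U) := isPhys_outer (δ β) hψ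
    have hVal := hV' β hβV _ (isPhys_valley (η β) hψoutP) fun U hU =>
      valley_support (hδ β) (hη β) (fun U => ∑ i, a i * e i U) hU
    have hvalout := l2_mul_le hψoutP (J := fun U => Real.cos (actionPhase (η β) U)) fun U => Real.abs_cos_le_one _
    have hsplit := l2_cos_add_l2_sin (measurable_innerPhase (δ β)) hψ
    rw [hin, hn] at hsplit
    -- floor of the span
    have hfloorK : levelValue su2Rep L β k * ∑ i, a i ^ 2 ≤ qform su2Rep β (fun U => ∑ i, a i * e i U) (fun U => ∑ i, a i * e i U) := by
      rw [hq, Finset.mul_sum]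
      refine Finset.sum_le_sum fun i _ => mul_le_mul_of_nonneg_right ?_ (sq_nonneg _)
      exact levelValue_le_of_le hβ0 (Nat.le_of_lt_succ i.2)
    have hnin0 : 0 ≤ l2 (fun U => ∑ i, a i * F i U) (fun U => ∑ i, a i * F i U) := l2_self_nonneg_lat _
    have hout0 := l2_self_nonneg_lat (fun U => Real.sin (innerPhase (δ β) U) * ∑ i, a i * e i U)
    refine ⟨hnin0, by linarith, ?_⟩
    have hEΛ0 : 0 ≤ E * levelValue su2Rep L β 0 := by positivity
    have hout_eq : l2 (fun U => Real.sin (innerPhase (δ β) U) * ∑ i, a i * e i U) (fun U => Real.sin (innerPhase (δ β) U) * ∑ i, a i * e i U)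
        = ∑ i, a i ^ 2 - l2 (fun U => ∑ i, a i * F i U) (fun U => ∑ i, a i * F i U) := by linarith [hsplit]
    have h3 := hVal.trans (mul_le_mul_of_nonneg_left (hvalout.trans hout_eq.le) hEΛ0)
    have h4 := mul_le_mul_of_nonneg_right herr (Finset.sum_nonneg fun i (_ : i ∈ Finset.univ) => sq_nonneg (a i))
    have h5 : levelValue su2Rep L β k * ∑ i, a i ^ 2 ≤ qform su2Rep β (fun U => ∑ i, a i * F i U) (fun U => ∑ i, a i * F i U)
        + E * levelValue su2Rep L β 0 * (∑ i, a i ^ 2 - l2 (fun U => ∑ i, a i * F i U) (fun U => ∑ i, a i * F i U))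
        + ε / 8 * bareLambda ((L : ℝ) ^ 3 * β) * levelValue su2Rep L β 0 * ∑ i, a i ^ 2 := by
      linarith [honion, h3, h4, hfloorK]
    have h6 := mul_le_mul_of_nonneg_right h5 hμ0.le
    linarith [h6]
  -- either the inner Gram matrix is degenerate (then the valley bound alone suffices) or the inner window applies
  by_cases hGram : ∀ a : Fin (k + 1) → ℝ, a ≠ 0 → 0 < l2 (fun U => ∑ i, a i * F i U) (fun U => ∑ i, a i * F i U)
  · obtain ⟨a, ha, hIa⟩ := hI' β hβI k F hFphys hFsupp hGram
    obtain ⟨hnin0, hnin1, hkey⟩ := key a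
    have hkey' : levelValue su2Rep L β k * levelValue su2Rep 1 ((L : ℝ) ^ 3 * β) 0 * ∑ i, a i ^ 2 ≤
        qform su2Rep β (fun U => ∑ i, a i * F i U) (fun U => ∑ i, a i * F i U) * levelValue su2Rep 1 ((L : ℝ) ^ 3 * β) 0
          + E * levelValue su2Rep L β 0 * levelValue su2Rep 1 ((L : ℝ) ^ 3 * β) 0 * (∑ i, a i ^ 2 - l2 (fun U => ∑ i, a i * F i U) (fun U => ∑ i, a i * F i U))
          + ε / 8 * bareLambda ((L : ℝ) ^ 3 * β) * levelValue su2Rep L β 0 * levelValue su2Rep 1 ((L : ℝ) ^ 3 * β) 0 * ∑ i, a i ^ 2 := hkey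
    exact window_onion_endgame (sum_sq_pos_of_ne_zero ha) hnin0 hnin1 hΛ0.le hμ0.le hlam0.le hε.le hE0 hθE hkey' hIa
  · push Not at hGram
    obtain ⟨a, ha, hle⟩ := hGram
    obtain ⟨hnin0, -, hkey⟩ := key a
    have hzero : l2 (fun U => ∑ i, a i * F i U) (fun U => ∑ i, a i * F i U) = 0 := le_antisymm hle hnin0
    have hq0 : qform su2Rep β (fun U => ∑ i, a i * F i U) (fun U => ∑ i, a i * F i U) ≤ 0 := by
      have h := qform_le_latCE_mul_l2 hβ0.le (isPhys_sum_mul_lat Finset.univ F hFphys a)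
      rw [hzero, mul_zero] at h; exact h
    rw [hzero] at hkey
    have hI0 : qform su2Rep β (fun U => ∑ i, a i * F i U) (fun U => ∑ i, a i * F i U) * levelValue su2Rep 1 ((L : ℝ) ^ 3 * β) 0 ≤
        (max (levelValue su2Rep 1 ((L : ℝ) ^ 3 * β) k) (θ * levelValue su2Rep 1 ((L : ℝ) ^ 3 * β) 0) +
          ε / 2 * bareLambda ((L : ℝ) ^ 3 * β) * levelValue su2Rep 1 ((L : ℝ) ^ 3 * β) 0) * levelValue su2Rep L β 0 * 0 := by
      rw [mul_zero]; exact mul_nonpos_of_nonpos_of_nonneg hq0 hμ0.le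
    exact window_onion_endgame (sum_sq_pos_of_ne_zero ha) le_rfl (Finset.sum_nonneg fun i _ => sq_nonneg (a i)) hΛ0.le hμ0.le hlam0.le hε.le
      hE0 hθE hkey hI0

/-- ★★★ **BO-WINDOW(L) at polynomial scales `(δ, η) = (β^{−p}, β^{−q})`, `0 < p < 1/3`, `q < 8/9`**, from the log-rate valley gain and the ONE-ORBIT `k`-uniform inner window
(eight copies ✓`innerWindowAt_pow_of_oneOrbit`, admissibility ✓`scalesAdmissible₂_powScale₉`). [cite: Luscher1983, §3] [cite: LuscherMunster1984, §2] -/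
theorem boWindow_pow {p q : ℝ} (hp0 : 0 < p) (hp : p < 1 / 3) (hq : q < 8 / 9)
    (hV : ValleyGainLogAt L (powScale p) (powScale q)) (hI : InnerWindowOneOrbitAt L (powScale p)) :
    ∀ c : ℝ, ∀ ε : ℝ, 0 < ε → ∃ β0 : ℝ, ∀ β : ℝ, β0 ≤ β → ∀ k : ℕ,
      levelValue su2Rep L β k * levelValue su2Rep 1 ((L : ℝ) ^ 3 * β) 0 ≤
        (max (levelValue su2Rep 1 ((L : ℝ) ^ 3 * β) k) (Real.exp (-(c * Real.log β * bareLambda ((L : ℝ) ^ 3 * β))) * levelValue su2Rep 1 ((L : ℝ) ^ 3 * β) 0) +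
            ε * bareLambda ((L : ℝ) ^ 3 * β) * levelValue su2Rep 1 ((L : ℝ) ^ 3 * β) 0) * levelValue su2Rep L β 0 :=
  boWindow_of_valleyLog_innerWindow₂ (scalesAdmissible₂_powScale₉ hp0 hp hq) hV (innerWindowAt_pow_of_oneOrbit hp0 hI)

end Summit.QuantumFields.YangMills.Theorems.FemtoTransferGap

end
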